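import Summits.CriticalPhenomena.PercolationContinuityZ3.Theses.PercShatteringRace

/-!
# Census signatures for crux stmt-CriticalPhenomena-5786 (`FreeSusceptibilityPowerSaving`, S(1/2))

Companion to `STRATEGY-CENSUS.md` (crux-strategist, wall-breaker gen 1, 2026-08-17).
THIS IS NOT A LINE SKELETON: it has no `stub_*`, registers nothing, and its two glue theorems are
records of the census's decomposition attempts (Dc3: sorried, ≈ 200 lines of layer-cake + Cauchy–Schwarz
if ever wanted; Dc7: proved, one-line-glue type).  It exists so that the typed statements quoted in the
census elaborate against the tree's declarations (catching ℕ/ℝ casts and binder shapes) and can be lifted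
verbatim by a planner who decides to file them.

* `KMax4`      — Dc3 child 1 (unrooted fourth moment of the in-box maximal cluster at scale `2R`).
* `NonProlif2` — Dc3 child 2 (unrooted second moment of the number of in-box clusters of volume ≥ ⌈R^{5/2}⌉).
* `BT`, `Frac` — Dc7 (boundary-touching rooted volume; fraction carried by boundary-touching clusters).
* `PersistForm` — S⁺2 / D4: S at the scale-dependent subcritical point `p_c − R^{−7/4}/68`
  (equivalent to the crux up to constants by the covariance form of Russo's formula; not proved here).
-/

namespace Summit.CriticalPhenomena.PercolationContinuityZ3.Cruxes.FreeSusceptibilityPowerSaving.Census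

open MeasureTheory Filter
open Literature.Probability.Percolation Literature.Probability.LatticeModels
open Summit.CriticalPhenomena.PercolationContinuityZ3.Theses.PercShatteringRace
open scoped Classical

noncomputable section

/-- The critical bond measure on `ℤ³`. -/
abbrev μc : Measure (BondConfig (Site 3)) := bondPercolation (zdGraph 3) (criticalProbI 3)

/-- The in-box (free-boundary) cluster of `x` in `Λ_R = box 3 R`, as a finset of sites. -/
def clusterIn (R : ℕ) (ω : BondConfig (Site 3)) (x : Site 3) : Finset (Site 3) :=
  (box 3 R).filter fun v => ω ∈ openConnIn (↑(box 3 R) : Set (Site 3)) x v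

/-- `|K_max(Λ_R)|` for the FREE box: the largest in-box cluster size. -/
def kmaxIn (R : ℕ) (ω : BondConfig (Site 3)) : ℕ :=
  (box 3 R).sup fun x => (clusterIn R ω x).card

/-- `N_fat(Λ_R; n)`: the number of distinct in-box clusters of `Λ_R` with at least `n` sites. -/
def nFat (R n : ℕ) (ω : BondConfig (Site 3)) : ℕ :=
  (((box 3 R).filter fun x => n ≤ (clusterIn R ω x).card).image fun x => clusterIn R ω x).card

/-- Dc3, child 1 — `KMAX₄(21/2)`: `E |K_max(Λ_{2R})|⁴ ≤ C R^{21/2}` (truth ≈ R^{10.09}; kills the monolith). -/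
def KMax4 : Prop :=
  ∃ C : ℝ, ∀ R : ℕ, 1 ≤ R →
    ∫ ω, ((kmaxIn (2 * R) ω : ℝ) ^ (4 : ℕ)) ∂μc ≤ C * (R : ℝ) ^ ((21 : ℝ) / 2)

/-- Dc3, child 2 — `NONPROLIF₂(1/2)`: `E N_fat(Λ_{2R}; ⌈R^{5/2}⌉)² ≤ C R^{1/2}` (truth ≈ R^{0.06};
kills proliferation of fat pieces; holds under BoxLRO). -/
def NonProlif2 : Prop :=
  ∃ C : ℝ, ∀ R : ℕ, 1 ≤ R →
    ∫ ω, ((nFat (2 * R) ⌈(R : ℝ) ^ ((5 : ℝ) / 2)⌉₊ ω : ℝ) ^ (2 : ℕ)) ∂μc ≤ C * (R : ℝ) ^ ((1 : ℝ) / 2)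

/-- Dc3 glue (RECORD ONLY, sorried): layer cake at `N₀ = ⌈R^{5/2}⌉`, box-inclusion averaging
`|C_{Λ_R}(0)| ≤ |C_{z+Λ_{2R}}(0)|` for `z ∈ Λ_R`, translation invariance, `Σ_{fat K}|K|² ≤ |K_max|²·N_fat`,
Cauchy–Schwarz: `χᶠ_R ≤ N₀ + (8R³)⁻¹ (E K_max⁴)^{1/2} (E N_fat²)^{1/2} ≤ C' R^{5/2}` since `21/4 + 1/4 − 3 = 5/2`.
Not filed as a split: both children are engine-less (census §5 Dc3). -/
theorem freeSusceptibilityPowerSaving_of_kmax4_nonProlif2 :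
    KMax4 → NonProlif2 → FreeSusceptibilityPowerSaving := by
  sorry

/-- Dc7 — `BT(1/2)`: the boundary-touching rooted volume
`Σ_y P(0 ↔ y in Λ_R, 0 ↔ ∂ⁱⁿΛ_R in Λ_R) ≤ C R^{5/2}` (all of S in the jump world). -/
def BT : Prop :=
  ∃ C : ℝ, ∀ R : ℕ, 1 ≤ R →
    ∑ y ∈ box 3 R, μc.real (openConnIn (↑(box 3 R) : Set (Site 3)) 0 y ∩ siteToBoundary 3 R)
      ≤ C * (R : ℝ) ^ ((5 : ℝ) / 2)

/-- Dc7 — `FRAC`: a constant fraction of the free susceptibility is carried by boundary-touching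
clusters (RSW-species lower bound; open in d = 3). -/
def Frac : Prop :=
  ∃ c : ℝ, 0 < c ∧ ∀ R : ℕ, 1 ≤ R →
    c * ∑ y ∈ box 3 R, μc.real (openConnIn (↑(box 3 R) : Set (Site 3)) 0 y)
      ≤ ∑ y ∈ box 3 R, μc.real (openConnIn (↑(box 3 R) : Set (Site 3)) 0 y ∩ siteToBoundary 3 R)

/-- Dc7 glue: `BT ∧ FRAC ⇒ S`, one division. -/
theorem freeSusceptibilityPowerSaving_of_bt_frac (hBT : BT) (hF : Frac) :
    FreeSusceptibilityPowerSaving := by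
  obtain ⟨C, hC⟩ := hBT
  obtain ⟨c, hc, hcR⟩ := hF
  refine ⟨C / c, fun R hR => ?_⟩
  have h1 := hcR R hR
  have h2 := hC R hR
  have h3 : c * ∑ y ∈ box 3 R, μc.real (openConnIn (↑(box 3 R) : Set (Site 3)) 0 y)
      ≤ C * (R : ℝ) ^ ((5 : ℝ) / 2) := le_trans h1 h2
  rw [div_mul_eq_mul_div, le_div_iff₀ hc]
  calc (∑ y ∈ box 3 R, (bondPercolation (zdGraph 3) (criticalProbI 3)).real
          (openConnIn (↑(box 3 R) : Set (Site 3)) 0 y)) * c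
        = c * ∑ y ∈ box 3 R, μc.real (openConnIn (↑(box 3 R) : Set (Site 3)) 0 y) := by
          rw [mul_comm]
    _ ≤ C * (R : ℝ) ^ ((5 : ℝ) / 2) := h3

/-- S⁺2 / D4 — `PERSIST`: S at the scale-dependent SUBcritical parameter `p_R = p_c − R^{−7/4}/68`
(clamped into `[0,1]`).  Equivalent to the crux up to constants (`√χᶠ_R(p_c) ≤ √χᶠ_R(p) + 48R³(p_c−p)`);
recorded, not proved here. -/
def PersistForm : Prop :=
  ∃ C : ℝ, ∀ R : ℕ, 1 ≤ R →
    ∑ y ∈ box 3 R,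
      (bondPercolation (zdGraph 3)
        (Set.projIcc (0 : ℝ) 1 zero_le_one
          ((criticalProbI 3 : ℝ) - (R : ℝ) ^ (-(7 : ℝ) / 4) / 68))).real
        (openConnIn (↑(box 3 R) : Set (Site 3)) 0 y)
      ≤ C * (R : ℝ) ^ ((5 : ℝ) / 2)

/-- The crux trivially implies `PersistForm` (monotonicity in `p` is the content; here we only record
the easy sanity check that `PersistForm` is at least as weak as asking the bound at every `p ≤ p_c`,
which `Disproof.crux_iff_uniform` shows equivalent to the crux).  Left as a remark; no proof obligations. -/
example : True := trivial

end

end Summit.CriticalPhenomena.PercolationContinuityZ3.Cruxes.FreeSusceptibilityPowerSaving.Census
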